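import Summits.NavierStokesRegularity.NavierStokesRegularity.Theorems.TypeIQuarterGateQuarterLawTypeISamplingTFAE
import Summits.NavierStokesRegularity.NavierStokesRegularity.Theorems.TypeIQuarterGatePerSolutionTFAE
import Summits.NavierStokesRegularity.NavierStokesRegularity.Theorems.TypeIQuarterGateQuarterLawTypeIBackwardWindow
import Summits.NavierStokesRegularity.NavierStokesRegularity.Theorems.TypeIQuarterGateQuarterLawTypeIExponentWindow
import HarnessLib

/-!
# `TypeIQuarterGate`: PORTRAIT OF A VIOLATOR — what a counterexample to `QuarterLawTypeI`
# (stmt-NavierStokesRegularity-23726) must do, all at once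

`--supports stmt-NavierStokesRegularity-23726` (helper; refuter-facing NODE).  The per-solution
equivalences of the crux (spatial: `LorentzOfEnvelope.typeI_slice_tfae`, p818868; temporal:
`QuarterLawOctave.quarterLaw_sampling_tfae`, p824842) and the a-priori caps (p820231, p823532) are
scattered over five files.  This file assembles them into ONE by-name statement
(`violator_portrait_of_not_quarterLawTypeI`): if `QuarterLawTypeI` fails, there is a maximal classical
Leray–Hopf solution `u` on `[0,T)` from a rapidly decaying datum with the sup-norm Type-I rate at `T`
(so a GENUINE Type-I blow-up) which SIMULTANEOUSLY

* (octaves) for every `K` and every ratio `q` has times `t → T` whose whole backward `q`-octave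
  `{s ∈ [0,t] : T−s ≤ q(T−t)}` violates `Z(s) ≤ K/√(T−s)` at every slice (`Z = ∫‖curl u‖²`);
* (dyadic) for every `K` violates `Z(T−T/2^{n+1}) ≤ K/√(T/2^{n+1})` at some dyadic time;
* (Lorentz) has UNBOUNDED weak-`L³` quasi-norms: `∀ M, ∃ t ∈ [0,T), eWeakLpPow (u t) 3 > M`
  (`LorentzUpgradeTypeI`, 24108, fails along `u`);
* (fat cells) for every `N` has slices whose near-top super-level set `{‖u(s)‖ > ½√(ν/(T−s))}` has
  volume `> N (ν(T−s))^{3/2}` (one-level volume sparseness fails);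
* (count) for some `η > 0`, carries arbitrarily many pairwise `2r`-separated `η`-concentrating parabolic
  cells `Q_r(x,T)` at arbitrarily small scales (`UniformConcentrationCountTypeI`, 23970, fails along `u`);
* (energy) for every `K` dissipates more than `K√(T−a)` over some terminal window `[a,T)` (the energy
  is not ½-Hölder at `T`);
* and NEVERTHELESS obeys the caps: `Z(t) ≤ K₁/(T−t)` on `[0,T)` and `(T−t)Z(t) → 0`
  (`∀ ε>0 ∃ t₀ ∀ t ∈ [t₀,T), Z(t) ≤ ε/(T−t)`).

`quarterLawTypeI_iff_no_violator` is the equivalence form.  Use: a refuter's witness must exhibit ALL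
of these; a prover may refute ANY ONE of them along every Type-I blow-up of the class.

HONEST FRAMING: pure assembly of landed per-solution equivalences about a HYPOTHETICAL blow-up;
`QuarterLawTypeI` remains OPEN; no violator is claimed to exist; nothing about Navier–Stokes regularity
is claimed. [folklore]
-/

-- the problem directory repeats the summit name (`NavierStokesRegularity/NavierStokesRegularity`)
set_option linter.dupNamespace false

noncomputable section

open Set Filter Topology MeasureTheory Metric
open scoped ENNReal NNReal

namespace Summit.NavierStokesRegularity.NavierStokesRegularity.Theorems

namespace QuarterLawOctave

open Literature.Analysis.FluidPDE Literature.Analysis.FunctionSpaces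
open Summit.NavierStokesRegularity.NavierStokesRegularity.Theses.TypeIQuarterGate

/-- **Portrait of a violator, per solution.** Along a maximal classical Leray–Hopf rapidly-decaying-datum
solution with the sup-norm Type-I rate at `T` along which the slice quarter law FAILS, all the failure
modes of the module docstring hold simultaneously, together with the a-priori caps. [folklore] -/
theorem violator_portrait {ν T : ℝ} (hν : 0 < ν) (hT : 0 < T)
    {u : ℝ → EuclideanSpace ℝ (Fin 3) → EuclideanSpace ℝ (Fin 3)}
    {p : ℝ → EuclideanSpace ℝ (Fin 3) → ℝ}
    (hmax : IsMaximalSmoothSolution ν 0 u p T) (hLH : IsLerayHopfOn T ν 0 (u 0) u)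
    (hdec : HasRapidSpatialDecay (u 0)) (hI : IsTypeIBlowup u T)
    (hfail : ¬ ∃ K : ℝ, ∀ t ∈ Ico 0 T,
      ∫⁻ x, ‖curl (u t) x‖ₑ ^ 2 ≤ ENNReal.ofReal (K / Real.sqrt (T - t))) :
    (∀ K q t₀ : ℝ, t₀ < T → ∃ t ∈ Ico t₀ T, ∀ s ∈ Icc 0 t, T - s ≤ q * (T - t) →
        ENNReal.ofReal (K / Real.sqrt (T - s)) < ∫⁻ x, ‖curl (u s) x‖ₑ ^ 2) ∧
    (∀ K : ℝ, ∃ n : ℕ, ENNReal.ofReal (K / Real.sqrt (T / 2 ^ (n + 1))) <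
        ∫⁻ x, ‖curl (u (T - T / 2 ^ (n + 1))) x‖ₑ ^ 2) ∧
    (∀ M' : ℝ, ∃ t ∈ Ico 0 T, ENNReal.ofReal M' < eWeakLpPow (u t) 3 volume) ∧
    (∀ N : ℝ, ∃ s ∈ Ico 0 T, ENNReal.ofReal (N * Real.sqrt (ν * (T - s)) ^ 3) <
        volume {x : EuclideanSpace ℝ (Fin 3) | (1 / 2 : ℝ) * Real.sqrt (ν / (T - s)) < ‖u s x‖}) ∧
    (∃ η : ℝ, 0 < η ∧ ∀ N : ℕ, ∀ r₀ : ℝ, 0 < r₀ → ∃ r : ℝ, 0 < r ∧ r ≤ r₀ ∧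
        ∃ σ : Finset (EuclideanSpace ℝ (Fin 3)),
          (∀ x ∈ σ, ∀ x' ∈ σ, x ≠ x' → 2 * r ≤ ‖x - x'‖) ∧
          (∀ x ∈ σ, ENNReal.ofReal (η * r) ≤ ∫⁻ s in Ioo (T - r ^ 2) T, ∫⁻ y in ball x r,
            ENNReal.ofReal (frobeniusNormSq (fderiv ℝ (u s) y))) ∧ N < σ.card) ∧
    (∀ K : ℝ, ∃ a ∈ Ico 0 T, ENNReal.ofReal (K * Real.sqrt (T - a)) <
        ∫⁻ s in Ioo a T, ∫⁻ x, ‖curl (u s) x‖ₑ ^ 2) ∧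
    (∃ K₁ : ℝ, ∀ t ∈ Ico 0 T, ∫⁻ x, ‖curl (u t) x‖ₑ ^ 2 ≤ ENNReal.ofReal (K₁ / (T - t))) ∧
    (∀ ε : ℝ, 0 < ε → ∃ t₀ ∈ Ico 0 T, ∀ t ∈ Ico t₀ T,
        ∫⁻ x, ‖curl (u t) x‖ₑ ^ 2 ≤ ENNReal.ofReal (ε / (T - t))) := by
  obtain ⟨C, hC⟩ := QuarterLawWindow.exists_rate_of_isTypeIBlowup' hν hI
  have htime := quarterLaw_sampling_tfae hν hT hmax.1 hLH hdec hI
  have hspace := LorentzOfEnvelope.typeI_slice_tfae (c₀ := 1 / 2) (by norm_num) (by norm_num)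
    hν hT hmax hLH hdec hI
  refine ⟨octaveViolation_of_not_quarterLaw hν hT hmax.1 hLH hdec hC hfail, ?_, ?_, ?_, ?_, ?_,
    QuarterLawExponent.enstrophyCapTypeI ν T hν hT u p hmax hLH hdec hI,
    QuarterLawBackwardWindow.enstrophy_isLittleO_inv_of_isTypeIBlowup ν T hν hT u p hmax hLH hdec hI⟩
  · have h := (htime.out 0 3).not.mp hfail
    push Not at h
    exact h
  · have h := (hspace.out 0 1).not.mp hfail
    push Not at h
    exact h
  · have h := (hspace.out 0 2).not.mp hfail
    push Not at h
    exact h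
  · have h := (hspace.out 0 3).not.mp hfail
    push Not at h
    obtain ⟨η, hη, hN⟩ := h
    refine ⟨η, hη, fun N r₀ hr₀ => ?_⟩
    obtain ⟨r, hr, hrr₀, σ, hsep, hconc, hcard⟩ := hN N r₀ hr₀
    exact ⟨r, hr, hrr₀, σ, hsep, hconc, hcard⟩
  · have h := (htime.out 0 5).not.mp hfail
    push Not at h
    exact h

/-- **BY NAME: `¬ QuarterLawTypeI` ⟹ a violator with the whole portrait.** [folklore] -/
theorem violator_portrait_of_not_quarterLawTypeI (h : ¬ QuarterLawTypeI) :
    ∃ (ν T : ℝ) (u : ℝ → EuclideanSpace ℝ (Fin 3) → EuclideanSpace ℝ (Fin 3))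
      (p : ℝ → EuclideanSpace ℝ (Fin 3) → ℝ),
      0 < ν ∧ 0 < T ∧ IsMaximalSmoothSolution ν 0 u p T ∧ IsLerayHopfOn T ν 0 (u 0) u ∧
      HasRapidSpatialDecay (u 0) ∧ IsTypeIBlowup u T ∧
      (∀ K q t₀ : ℝ, t₀ < T → ∃ t ∈ Ico t₀ T, ∀ s ∈ Icc 0 t, T - s ≤ q * (T - t) →
          ENNReal.ofReal (K / Real.sqrt (T - s)) < ∫⁻ x, ‖curl (u s) x‖ₑ ^ 2) ∧
      (∀ K : ℝ, ∃ n : ℕ, ENNReal.ofReal (K / Real.sqrt (T / 2 ^ (n + 1))) <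
          ∫⁻ x, ‖curl (u (T - T / 2 ^ (n + 1))) x‖ₑ ^ 2) ∧
      (∀ M' : ℝ, ∃ t ∈ Ico 0 T, ENNReal.ofReal M' < eWeakLpPow (u t) 3 volume) ∧
      (∀ N : ℝ, ∃ s ∈ Ico 0 T, ENNReal.ofReal (N * Real.sqrt (ν * (T - s)) ^ 3) <
          volume {x : EuclideanSpace ℝ (Fin 3) |
            (1 / 2 : ℝ) * Real.sqrt (ν / (T - s)) < ‖u s x‖}) ∧
      (∃ η : ℝ, 0 < η ∧ ∀ N : ℕ, ∀ r₀ : ℝ, 0 < r₀ → ∃ r : ℝ, 0 < r ∧ r ≤ r₀ ∧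
          ∃ σ : Finset (EuclideanSpace ℝ (Fin 3)),
            (∀ x ∈ σ, ∀ x' ∈ σ, x ≠ x' → 2 * r ≤ ‖x - x'‖) ∧
            (∀ x ∈ σ, ENNReal.ofReal (η * r) ≤ ∫⁻ s in Ioo (T - r ^ 2) T, ∫⁻ y in ball x r,
              ENNReal.ofReal (frobeniusNormSq (fderiv ℝ (u s) y))) ∧ N < σ.card) ∧
      (∀ K : ℝ, ∃ a ∈ Ico 0 T, ENNReal.ofReal (K * Real.sqrt (T - a)) <
          ∫⁻ s in Ioo a T, ∫⁻ x, ‖curl (u s) x‖ₑ ^ 2) ∧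
      (∃ K₁ : ℝ, ∀ t ∈ Ico 0 T, ∫⁻ x, ‖curl (u t) x‖ₑ ^ 2 ≤ ENNReal.ofReal (K₁ / (T - t))) ∧
      (∀ ε : ℝ, 0 < ε → ∃ t₀ ∈ Ico 0 T, ∀ t ∈ Ico t₀ T,
          ∫⁻ x, ‖curl (u t) x‖ₑ ^ 2 ≤ ENNReal.ofReal (ε / (T - t))) := by
  unfold QuarterLawTypeI at h
  push Not at h
  obtain ⟨ν, T, hν, hT, u, p, hmax, hLH, hdec, hI, hfail⟩ := h
  have hfail' : ¬ ∃ K : ℝ, ∀ t ∈ Ico 0 T,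
      ∫⁻ x, ‖curl (u t) x‖ₑ ^ 2 ≤ ENNReal.ofReal (K / Real.sqrt (T - t)) := by
    push Not
    exact hfail
  exact ⟨ν, T, u, p, hν, hT, hmax, hLH, hdec, hI, violator_portrait hν hT hmax hLH hdec hI hfail'⟩

/-- **`QuarterLawTypeI` ⟺ NO solution of the class is dyadically unbounded** — the shortest
single-property refutation target: K1 holds iff along every maximal classical Leray–Hopf
rapidly-decaying-datum Type-I blow-up the dyadic samples `Z(T−T/2^{n+1})·√(T/2^{n+1})` are bounded.
(`quarterLawTypeI_iff_dyadic` re-exported next to the portrait.) [folklore] -/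
theorem quarterLawTypeI_iff_no_dyadic_violator :
    QuarterLawTypeI ↔
      ¬ ∃ (ν T : ℝ) (u : ℝ → EuclideanSpace ℝ (Fin 3) → EuclideanSpace ℝ (Fin 3))
          (p : ℝ → EuclideanSpace ℝ (Fin 3) → ℝ),
          0 < ν ∧ 0 < T ∧ IsMaximalSmoothSolution ν 0 u p T ∧ IsLerayHopfOn T ν 0 (u 0) u ∧
          HasRapidSpatialDecay (u 0) ∧ IsTypeIBlowup u T ∧
          ∀ K : ℝ, ∃ n : ℕ, ENNReal.ofReal (K / Real.sqrt (T / 2 ^ (n + 1))) <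
            ∫⁻ x, ‖curl (u (T - T / 2 ^ (n + 1))) x‖ₑ ^ 2 := by
  rw [quarterLawTypeI_iff_dyadic]
  constructor
  · rintro h ⟨ν, T, u, p, hν, hT, hmax, hLH, hdec, hI, hbad⟩
    obtain ⟨K, hK⟩ := h ν T hν hT u p hmax hLH hdec hI
    obtain ⟨n, hn⟩ := hbad K
    exact absurd (hK n) (not_le.2 hn)
  · intro h ν T hν hT u p hmax hLH hdec hI
    by_contra hK
    push Not at hK
    exact h ⟨ν, T, u, p, hν, hT, hmax, hLH, hdec, hI, hK⟩

end QuarterLawOctave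

end Summit.NavierStokesRegularity.NavierStokesRegularity.Theorems
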